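import Literature.Probability.RandomPlanarGeometry.BrownianPathFreezing
import HarnessLib

/-!
# Freezing the past for integrable functionals of the Brownian path

The freezing formula `integral_mul_eq_integral_integral_concat` of `BrownianPathFreezing` (simple
Markov property of the canonical Brownian motion, for functionals of the continuous path
`β(ω) ∈ C(ℝ≥0, ℝ)`) assumes both functionals `H, Φ` bounded. Functionals with Gaussian tails (the
increments of the image driving function `W̃` of [LSW 2003] §5) need the version proved here:
`H` bounded measurable, `Φ` measurable with `Φ ∘ β` integrable under the pre-Wiener measure,

  `E[H(stop_s β) · Φ(β)] = E_ω[H(stop_s β(ω)) · E_{ω₂}[Φ(concat_s(stop_s β(ω), β(ω₂)))]]`,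

together with the integrability of the frozen conditional expectation
`ω ↦ E_{ω₂}[Φ(concat_s(stop_s β(ω), β(ω₂)))]` (`integral_mul_eq_integral_integral_concat_of_integrable`).

Proof: the joint law of `(stop_s β, incr_s β)` is the product of the marginals
(`indepFun_incr_stop`), the law of `incr_s β` is the law of `β` (`identDistrib_incr`), and
`β = concat_s(stop_s β, incr_s β)` (`concat_stop_incr`); hence `(p, q) ↦ Φ(concat_s(p, q))` is
integrable for the product of the law of `stop_s β` with the law of `β` (its pull-back along
`(stop_s β, incr_s β)` is `Φ ∘ β`), and Fubini's theorem for integrable functions applies.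

## References

* J.-F. Le Gall, *Brownian Motion, Martingales, and Stochastic Calculus* (2016), Prop. 2.5 (iii)
  (simple Markov property) [Legall2016].
* G. F. Lawler, O. Schramm, W. Werner, *Conformal restriction: the chordal case* (2003), §5
  [LawlerSchrammWerner2003Restriction].
-/

noncomputable section

open MeasureTheory ProbabilityTheory Filter Set Function
open Literature.Probability.Process (brownian preWienerMeasure)
open scoped NNReal Topology

namespace Literature.Probability.RandomPlanarGeometry

open PathOps

/-- **Freezing the past, integrable version (simple Markov property).** For `H` bounded measurable
and `Φ` measurable with `Φ ∘ β` integrable, the frozen conditional expectation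
`ω ↦ E_{ω₂}[Φ(concat_s(stop_s β(ω), β(ω₂)))]` is integrable and
`E[H(stop_s β) Φ(β)] = E_ω[H(stop_s β(ω)) · E_{ω₂}[Φ(concat_s(stop_s β(ω), β(ω₂)))]]`.
[cite: Legall2016, Prop. 2.5 (iii)] -/
theorem integral_mul_eq_integral_integral_concat_of_integrable [MeasurableSpace C(ℝ≥0, ℝ)] [BorelSpace C(ℝ≥0, ℝ)]
    (s : ℝ≥0) {H Φ : C(ℝ≥0, ℝ) → ℝ} (hHm : Measurable H) (hΦm : Measurable Φ) {C : ℝ}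
    (hH : ∀ p, |H p| ≤ C) (hΦi : Integrable (fun ω ↦ Φ (brownianCPath ω)) preWienerMeasure) :
    Integrable (fun ω ↦ ∫ ω₂, Φ (concat s (stop s (brownianCPath ω), brownianCPath ω₂)) ∂preWienerMeasure)
        preWienerMeasure ∧
      ∫ ω, H (stop s (brownianCPath ω)) * Φ (brownianCPath ω) ∂preWienerMeasure =
        ∫ ω, H (stop s (brownianCPath ω)) *
          (∫ ω₂, Φ (concat s (stop s (brownianCPath ω), brownianCPath ω₂)) ∂preWienerMeasure)
            ∂preWienerMeasure := by
  haveI := isProbabilityMeasure_preWienerMeasure'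
  set X : (ℝ≥0 → ℝ) → C(ℝ≥0, ℝ) := fun ω ↦ stop s (brownianCPath ω) with hX
  set Yv : (ℝ≥0 → ℝ) → C(ℝ≥0, ℝ) := fun ω ↦ incr s (brownianCPath ω) with hYv
  have hXm : Measurable X := (measurable_stop s).comp measurable_brownianCPath
  have hYm : Measurable Yv := (measurable_incr s).comp measurable_brownianCPath
  -- the two functionals on pairs of paths
  set G : C(ℝ≥0, ℝ) × C(ℝ≥0, ℝ) → ℝ := fun pq ↦ Φ (concat s pq) with hG
  set F : C(ℝ≥0, ℝ) × C(ℝ≥0, ℝ) → ℝ := fun pq ↦ H pq.1 * G pq with hF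
  have hGm : Measurable G := hΦm.comp (measurable_concat s)
  have hFm : Measurable F := (hHm.comp measurable_fst).mul hGm
  -- the joint law of (past, increments) is the product of the law of the past with the law of the path
  have hpair : Measure.map (fun ω ↦ (X ω, Yv ω)) preWienerMeasure =
      (Measure.map X preWienerMeasure).prod (Measure.map Yv preWienerMeasure) :=
    (indepFun_iff_map_prod_eq_prod_map_map hXm.aemeasurable hYm.aemeasurable).1 (indepFun_incr_stop s).symm
  rw [(identDistrib_incr s).map_eq] at hpair
  haveI : IsProbabilityMeasure (Measure.map X preWienerMeasure) := Measure.isProbabilityMeasure_map hXm.aemeasurable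
  haveI : IsProbabilityMeasure (Measure.map brownianCPath preWienerMeasure) :=
    Measure.isProbabilityMeasure_map measurable_brownianCPath.aemeasurable
  -- `G` is integrable for the product law: its pull-back along `(X, Yv)` is `Φ ∘ β`
  have hGi : Integrable G ((Measure.map X preWienerMeasure).prod (Measure.map brownianCPath preWienerMeasure)) := by
    rw [← hpair, integrable_map_measure hGm.aestronglyMeasurable (hXm.prodMk hYm).aemeasurable]
    have he : G ∘ (fun ω ↦ (X ω, Yv ω)) = fun ω ↦ Φ (brownianCPath ω) := by
      funext ω; simp only [Function.comp_apply, hG, hX, hYv, concat_stop_incr]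
    rw [he]; exact hΦi
  have hFi : Integrable F ((Measure.map X preWienerMeasure).prod (Measure.map brownianCPath preWienerMeasure)) :=
    hGi.bdd_mul (hHm.comp measurable_fst).aestronglyMeasurable
      (Eventually.of_forall fun pq ↦ by rw [Real.norm_eq_abs]; exact hH pq.1)
  -- integrals against the law of the path are integrals over `ω₂`
  have hinner : ∀ K : C(ℝ≥0, ℝ) × C(ℝ≥0, ℝ) → ℝ, Measurable K → ∀ p : C(ℝ≥0, ℝ),
      ∫ q, K (p, q) ∂(Measure.map brownianCPath preWienerMeasure) = ∫ ω₂, K (p, brownianCPath ω₂) ∂preWienerMeasure :=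
    fun K hK p ↦ by
      rw [integral_map measurable_brownianCPath.aemeasurable]
      exact (hK.comp (measurable_const.prodMk measurable_id)).aestronglyMeasurable
  -- Fubini: the partial integrals are integrable for the law of the past
  have hGo : Integrable (fun p ↦ ∫ ω₂, G (p, brownianCPath ω₂) ∂preWienerMeasure) (Measure.map X preWienerMeasure) := by
    have h := hGi.integral_prod_left
    simp_rw [hinner G hGm] at h
    exact h
  have hFo : Integrable (fun p ↦ ∫ ω₂, F (p, brownianCPath ω₂) ∂preWienerMeasure) (Measure.map X preWienerMeasure) := by
    have h := hFi.integral_prod_left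
    simp_rw [hinner F hFm] at h
    exact h
  refine ⟨hGo.comp_measurable hXm, ?_⟩
  -- the left side is `∫ F (X, Yv)`; push forward to the product law and apply Fubini
  have h1 : (fun ω ↦ H (stop s (brownianCPath ω)) * Φ (brownianCPath ω)) = fun ω ↦ F (X ω, Yv ω) := by
    funext ω; simp only [hF, hG, hX, hYv, concat_stop_incr]
  have h2 : ∫ ω, F (X ω, Yv ω) ∂preWienerMeasure =
      ∫ pq, F pq ∂(Measure.map (fun ω ↦ (X ω, Yv ω)) preWienerMeasure) := by
    rw [integral_map (hXm.prodMk hYm).aemeasurable hFm.aestronglyMeasurable]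
  rw [h1, h2, hpair, integral_prod F hFi]
  simp_rw [hinner F hFm]
  rw [integral_map hXm.aemeasurable hFo.aestronglyMeasurable]
  simp only [hF, hG, hX]
  congr 1; funext ω
  rw [← integral_const_mul]

end Literature.Probability.RandomPlanarGeometry

end
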